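import Mathlib
import HarnessLib
import Literature.Computability.AlgebraicComplexity.PatternExpressions
import Literature.Computability.AlgebraicComplexity.DiPatternExpressions
import Literature.Combinatorics.SimpleGraph.TreeDecomposition
import Literature.Combinatorics.SimpleGraph.TreewidthBrambleLowerBound
import Summits.ValiantsHypothesis.ValiantsHypothesis.Theorems.MonotoneRestorationOrbitRestorationLinearVolumeQPHomPolyBasics
import Summits.ValiantsHypothesis.ValiantsHypothesis.Theorems.MonotoneRestorationOrbitRestorationLinearVolumeQPSubThresholdDescentTools

/-!
# Route MonotoneRestoration — aside `OrbitRestorationLinearVolumeQP` (stmt-ValiantsHypothesis-18294):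
# BLOCK DESCENT — the off-diagonal block substitution carries ONE-SORTED narrowness at level `n + n` to
# BIPARTITE narrowness at level `n`, SAME WIDTH, IN EVERY DEGREE

The registered skeleton of R1 (line `birth`, `0500973389fe`) rests on `stub_lvNarrowSpan : LvNarrowSpan` (every
`VP ∩ LV` family lies level by level in the span of the homomorphism polynomials of BIPARTITE patterns of treewidth
`≤ (log₂ n + c)^c`), whereas the crux is EQUIVALENT to the one-sorted statement `LvDiNarrowSpan`
(`…DiNarrowSpanTight.orbitRestorationLinearVolumeQP_iff_lvDiNarrowSpan`).  The gap between the two is DESCENT: a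
matrix-symmetric polynomial with a narrow ONE-SORTED expansion should be narrow BIPARTITELY.  Descent is a tree
theorem below the injective threshold (`SubThresholdDescent.subThreshold_descent`: `2 · deg p ≤ n`, same level, no
loss) and OPEN above it (item evidence `R1-DESCENT-g1.md`, `DESCENT-SUBTHRESHOLD-g6.md`, `UNFOLDING-g8.md`: the only
VH-free residue of the line).

THIS FILE ADDS A SECOND, DEGREE-FREE DESCENT MECHANISM: the OFF-DIAGONAL BLOCK SUBSTITUTION
`Φ : ℂ[y_ij : i, j < n + n] → ℂ[x_ij : i, j < n]`, `y_(inl i, inr j) ↦ x_(i,j)`, every other variable `↦ 0`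
(equivalently `Y ↦ X ⊗ N` with `N` the nilpotent `2 × 2` Jordan block; in hypothesis form: any `φ` with the four
block equations, `exists_block`).

* `aeval_block_diHomPoly` — KEY FORMULA: `Φ(dihom_{D,n+n}) = N_D • dihom_{D,n}`, `N_D` = the number of CONSISTENT
  2-colourings of `D` (tails in the row block, heads in the column block) = `hom(D, directed edge)`; so `Φ` KILLS
  every pattern with a through-vertex (in particular every loop, e.g. the trace) and keeps the bipartite-shaped ones;
* `exists_homPoly_eq_diHomPoly_of_colouring` — DEORIENTATION: a consistently 2-coloured one-sorted pattern is a
  bipartite pattern (`false`-vertices = rows, `true`-vertices = columns) with the same homomorphism polynomial at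
  every level, the same number of edges, `a + b = #V`, and treewidth `≤ tw D` (injective graph homomorphism,
  `treewidth_le_of_hom_injective`);
* `block_descent_span` — **BLOCK DESCENT (span form): `Φ` maps the one-sorted narrow span of width `w` at level
  `n + n` (patterns of any order, ANY DEGREE) into the bipartite narrow span of the SAME width `w` at level `n`;**
* `aeval_block_homPoly`, `aeval_block_homPoly_of_noIsolated` — on bipartite patterns `Φ(hom_{E,n+n}) = N • hom_{E,n}`,
  `N = 2^{#isolated} ≥ 1`, and `= hom_{E,n}` exactly when `E` has no isolated vertices: `Φ` READS A BIPARTITE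
  EXPANSION ONE LEVEL DOWN;
* `block_descent_uniform` — **BLOCK DESCENT FOR UNIFORM DATA, EVERY DEGREE: if a formal combination
  `Σ_i α_i hom_{E_i}` of bipartite patterns (no isolated vertices, any volume, any degree) is one-sortedly narrow of
  width `w` when evaluated at level `n + n`, then it is bipartitely narrow of width `w` when evaluated at level `n`.**

READING FOR THE ITEM (honest label).  Sub-threshold descent settles the gap at a FIXED level for degrees `≤ n/2`;
block descent settles it in EVERY degree at the price of reading the expansion one level down.  Consequently (companion
file `…BlockDescentRestricted.lean`) R1 implies the registered stub's conclusion for every RESTRICTED family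
`f↓_n := Φ(f_{n+n})` of a `VP ∩ LV` family `f` (and `f ↦ f↓` preserves `VP ∩ LV`), i.e. the stub and the crux AGREE
on restricted families; what remains of the descent question is exactly the passage from `Φ(f_{n+n})` (the
level-`n + n` expansion read at level `n`) to `f_n` itself — a LIFTING / level-uniformity property of the expansion
data, absent from the item as filed.  The stub `stub_lvNarrowSpan` (Dwivedi–Pago–Seppelt Outlook Q3 at qp scale),
R1 and VP ≠ VNP are NOT moved.  Def-free helper (`--supports stmt-ValiantsHypothesis-18294`); nothing here is a named
fact; route-independent (imports no `Theses` file; the orientation identity is the tree's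
`SubThresholdDescent.diHomPoly_orientFin`).

References: Dwivedi–Pago–Seppelt 2026 (arXiv:2601.09343) eq. (1), Outlook Q3; Dawar–Pago–Seppelt 2025
(arXiv:2502.06740) Thm 1.1, Remark p. 17, §7 p. 45; Lovász, *Large networks and graph limits* (2012) eq. (5.30)
(`hom(F, G₁ × G₂) = hom(F, G₁) · hom(F, G₂)`, the identity behind the key formula).
-/

noncomputable section

open scoped Classical

-- `Summit.ValiantsHypothesis.ValiantsHypothesis.…` is the tree's single-conjunct layout (Sub = Summit).
set_option linter.dupNamespace false

namespace Summit.ValiantsHypothesis.ValiantsHypothesis.Theorems.BlockDescent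

open Literature.Computability.AlgebraicComplexity MvPolynomial
open Literature.Combinatorics.SimpleGraph (treewidth treewidth_le_of_hom_injective)
open Summit.ValiantsHypothesis.ValiantsHypothesis.Theorems

variable {n : ℕ}

/-! ### The off-diagonal block substitution (hypothesis form) -/

/-- Pointwise form of an off-diagonal block substitution on block coordinates: writing an index of
`Fin (n + n)` as `(side, i)` with `side = false` the ROW block (`Fin.castAdd`) and `side = true` the COLUMN
block (`Fin.natAdd`), the substitution reads `x_(i,j)` on (row block) × (column block) and `0` elsewhere.
[folklore] -/
theorem block_apply (φ : Fin (n + n) × Fin (n + n) → MvPolynomial (Fin n × Fin n) ℂ)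
    (hφ : ∀ i j : Fin n, φ (finSumFinEquiv (Sum.inl i), finSumFinEquiv (Sum.inr j)) = X (i, j) ∧
      φ (finSumFinEquiv (Sum.inl i), finSumFinEquiv (Sum.inl j)) = 0 ∧
      φ (finSumFinEquiv (Sum.inr i), finSumFinEquiv (Sum.inl j)) = 0 ∧
      φ (finSumFinEquiv (Sum.inr i), finSumFinEquiv (Sum.inr j)) = 0)
    (s t : Bool) (i j : Fin n) :
    φ (finSumFinEquiv (Equiv.boolProdEquivSum (Fin n) (s, i)),
        finSumFinEquiv (Equiv.boolProdEquivSum (Fin n) (t, j))) =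
      if s = false ∧ t = true then X (i, j) else 0 := by
  obtain ⟨h1, h2, h3, h4⟩ := hφ i j
  cases s <;> cases t
  · show φ (finSumFinEquiv (Sum.inl i), finSumFinEquiv (Sum.inl j)) = _
    rw [if_neg (by simp)]; exact h2
  · show φ (finSumFinEquiv (Sum.inl i), finSumFinEquiv (Sum.inr j)) = _
    rw [if_pos (by simp)]; exact h1
  · show φ (finSumFinEquiv (Sum.inr i), finSumFinEquiv (Sum.inl j)) = _
    rw [if_neg (by simp)]; exact h3
  · show φ (finSumFinEquiv (Sum.inr i), finSumFinEquiv (Sum.inr j)) = _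
    rw [if_neg (by simp)]; exact h4

/-- The edge product of a one-sorted pattern under a block substitution, at a label assignment written in
block coordinates `(c, g)`: it is the level-`n` edge product at `g` if the 2-colouring `c` is CONSISTENT
(every edge goes from the row block to the column block) and `0` otherwise. [folklore] -/
theorem prod_block_eq (φ : Fin (n + n) × Fin (n + n) → MvPolynomial (Fin n × Fin n) ℂ)
    (hφ : ∀ i j : Fin n, φ (finSumFinEquiv (Sum.inl i), finSumFinEquiv (Sum.inr j)) = X (i, j) ∧
      φ (finSumFinEquiv (Sum.inl i), finSumFinEquiv (Sum.inl j)) = 0 ∧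
      φ (finSumFinEquiv (Sum.inr i), finSumFinEquiv (Sum.inl j)) = 0 ∧
      φ (finSumFinEquiv (Sum.inr i), finSumFinEquiv (Sum.inr j)) = 0)
    {V : Type} [Fintype V] [DecidableEq V] (D : Multiset (V × V)) (c : V → Bool) (g : V → Fin n) :
    (D.map fun d => φ (finSumFinEquiv (Equiv.boolProdEquivSum (Fin n) (c d.1, g d.1)),
        finSumFinEquiv (Equiv.boolProdEquivSum (Fin n) (c d.2, g d.2)))).prod =
      if (∀ d ∈ D, c d.1 = false ∧ c d.2 = true) then
        (D.map fun d => (X (g d.1, g d.2) : MvPolynomial (Fin n × Fin n) ℂ)).prod else 0 := by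
  split_ifs with hc
  · congr 1
    refine Multiset.map_congr rfl fun d hd => ?_
    rw [block_apply φ hφ, if_pos (hc d hd)]
  · push Not at hc
    obtain ⟨d, hd, hbad⟩ := hc
    refine Multiset.prod_eq_zero (Multiset.mem_map.2 ⟨d, hd, ?_⟩)
    rw [block_apply φ hφ, if_neg (fun h => hbad h.1 h.2)]

/-! ### Block substitution of one-sorted homomorphism polynomials -/

/-- **KEY FORMULA.**  Under an off-diagonal block substitution, the one-sorted homomorphism polynomial of a
pattern `D` at level `n + n` becomes `N_D • dihom_{D,n}`, where `N_D` is the number of CONSISTENT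
2-colourings of `D` (tails in the row block, heads in the column block) — the number of homomorphisms of
`D` into the single directed edge; it is `0` unless `D` is bipartite-shaped (no vertex is both a tail and a
head).  (Homomorphism counts into a tensor product factor; here the second factor is the directed edge.)
[folklore] -/
theorem aeval_block_diHomPoly (φ : Fin (n + n) × Fin (n + n) → MvPolynomial (Fin n × Fin n) ℂ)
    (hφ : ∀ i j : Fin n, φ (finSumFinEquiv (Sum.inl i), finSumFinEquiv (Sum.inr j)) = X (i, j) ∧
      φ (finSumFinEquiv (Sum.inl i), finSumFinEquiv (Sum.inl j)) = 0 ∧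
      φ (finSumFinEquiv (Sum.inr i), finSumFinEquiv (Sum.inl j)) = 0 ∧
      φ (finSumFinEquiv (Sum.inr i), finSumFinEquiv (Sum.inr j)) = 0)
    {V : Type} [Fintype V] [DecidableEq V] (D : Multiset (V × V)) :
    aeval φ (diHomPoly D (n + n) ℂ) =
      ((Finset.univ.filter fun c : V → Bool => ∀ d ∈ D, c d.1 = false ∧ c d.2 = true).card : ℂ) •
        diHomPoly D n ℂ := by
  unfold diHomPoly
  rw [map_sum]
  simp only [map_multiset_prod, Multiset.map_map, Function.comp_def, aeval_X]
  -- block coordinates for label assignments `V → Fin (n + n)`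
  let e : (V → Bool) × (V → Fin n) ≃ (V → Fin (n + n)) :=
    (Equiv.arrowProdEquivProdArrow V (fun _ => Bool) (fun _ => Fin n)).symm.trans
      ((Equiv.refl V).arrowCongr ((Equiv.boolProdEquivSum (Fin n)).trans finSumFinEquiv))
  have he : ∀ (cg : (V → Bool) × (V → Fin n)) (u : V),
      e cg u = finSumFinEquiv (Equiv.boolProdEquivSum (Fin n) (cg.1 u, cg.2 u)) := fun cg u => rfl
  rw [← Fintype.sum_equiv e (fun cg => (D.map fun d => φ (e cg d.1, e cg d.2)).prod) _ (fun cg => rfl)]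
  simp only [he]
  rw [Fintype.sum_prod_type]
  simp only [prod_block_eq φ hφ D]
  simp only [Finset.sum_ite_irrel, Finset.sum_const_zero]
  rw [← Finset.sum_filter, Finset.sum_const, ← Nat.cast_smul_eq_nsmul ℂ]


/-! ### Bipartite-shaped one-sorted patterns are bipartite patterns of the same treewidth -/

/-- **Deorientation.**  A one-sorted pattern `D` with a consistent 2-colouring `c` (tails coloured `false`,
heads coloured `true`) is a BIPARTITE pattern: reading the `false`-vertices as rows and the `true`-vertices as
columns gives a pattern `F` on `Fin a × Fin b` with the same number of edges, `a + b = #V`,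
`hom_{F,m} = dihom_{D,m}` at every level `m`, and treewidth at most that of `D` (its pattern graph embeds
into the pattern graph of `D`). [folklore] -/
theorem exists_homPoly_eq_diHomPoly_of_colouring {V : Type} [Fintype V] [DecidableEq V]
    (D : Multiset (V × V)) (c : V → Bool) (hc : ∀ d ∈ D, c d.1 = false ∧ c d.2 = true) (m : ℕ) :
    ∃ (a b : ℕ) (F : Multiset (Fin a × Fin b)),
      treewidth (SimpleGraph.fromRel fun u v : Fin a ⊕ Fin b => ∃ e ∈ F, u = Sum.inl e.1 ∧ v = Sum.inr e.2) ≤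
          treewidth (SimpleGraph.fromRel fun u v : V => ∃ e ∈ D, u = e.1 ∧ v = e.2) ∧
        homPoly F m ℂ = diHomPoly D m ℂ ∧ a + b = Fintype.card V ∧ Multiset.card F = Multiset.card D := by
  -- rows: colour `false`; columns: colour `≠ false`
  let A := {u : V // c u = false}
  let B := {u : V // ¬ c u = false}
  let E : Multiset (A × B) := D.attach.map fun x =>
    (⟨x.1.1, (hc x.1 x.2).1⟩, ⟨x.1.2, by simp [(hc x.1 x.2).2]⟩)
  have hEmap : E.map (fun e => ((e.1 : V), (e.2 : V))) = D := by
    simp only [E, Multiset.map_map, Function.comp_def, Prod.mk.eta, Multiset.attach_map_val]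
  -- (i) the homomorphism polynomials agree
  have hhom : homPoly E m ℂ = diHomPoly D m ℂ := by
    unfold homPoly diHomPoly
    symm
    refine Fintype.sum_equiv (Equiv.piEquivPiSubtypeProd (fun u => c u = false) (fun _ => Fin m)) _ _
      fun g => ?_
    conv_lhs => rw [← hEmap]
    simp only [Multiset.map_map, Function.comp_def, Equiv.piEquivPiSubtypeProd_apply]
  -- (ii) transport to `Fin`
  let ea : A ≃ Fin (Fintype.card A) := Fintype.equivFin A
  let eb : B ≃ Fin (Fintype.card B) := Fintype.equivFin B
  let F : Multiset (Fin (Fintype.card A) × Fin (Fintype.card B)) := E.map fun e => (ea e.1, eb e.2)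
  refine ⟨Fintype.card A, Fintype.card B, F, ?_, ?_, ?_, ?_⟩
  · -- (iii) the bipartite pattern graph of `F` embeds into the pattern graph of `D`
    let ψ : Fin (Fintype.card A) ⊕ Fin (Fintype.card B) → V :=
      Sum.elim (fun i => ((ea.symm i : A) : V)) (fun j => ((eb.symm j : B) : V))
    have hψinj : Function.Injective ψ := by
      rintro (i | j) (i' | j') h
      · simp only [ψ, Sum.elim_inl] at h
        rw [Subtype.coe_inj.1 h |> ea.symm.injective]
      · simp only [ψ, Sum.elim_inl, Sum.elim_inr] at h
        exact absurd ((ea.symm i).2) (by rw [h]; exact (eb.symm j').2)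
      · simp only [ψ, Sum.elim_inl, Sum.elim_inr] at h
        exact absurd ((ea.symm i').2) (by rw [← h]; exact (eb.symm j).2)
      · simp only [ψ, Sum.elim_inr] at h
        rw [Subtype.coe_inj.1 h |> eb.symm.injective]
    have hedge : ∀ e ∈ F, ∃ d ∈ D, ψ (Sum.inl e.1) = d.1 ∧ ψ (Sum.inr e.2) = d.2 := by
      intro e he
      obtain ⟨x, hx, rfl⟩ := Multiset.mem_map.1 he
      obtain ⟨d, hd, rfl⟩ := Multiset.mem_map.1 hx
      exact ⟨d.1, d.2, by simp [ψ], by simp [ψ]⟩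
    let Ψ : (SimpleGraph.fromRel fun u v : Fin (Fintype.card A) ⊕ Fin (Fintype.card B) =>
          ∃ e ∈ F, u = Sum.inl e.1 ∧ v = Sum.inr e.2) →g
        (SimpleGraph.fromRel fun u v : V => ∃ e ∈ D, u = e.1 ∧ v = e.2) :=
      { toFun := ψ
        map_rel' := fun {u v} huv => by
          rw [SimpleGraph.fromRel_adj] at huv ⊢
          refine ⟨hψinj.ne huv.1, ?_⟩
          rcases huv.2 with ⟨e, he, rfl, rfl⟩ | ⟨e, he, rfl, rfl⟩
          · obtain ⟨d, hd, h1, h2⟩ := hedge e he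
            exact Or.inl ⟨d, hd, h1, h2⟩
          · obtain ⟨d, hd, h1, h2⟩ := hedge e he
            exact Or.inr ⟨d, hd, h1, h2⟩ }
    exact treewidth_le_of_hom_injective Ψ hψinj
  · rw [← hhom]
    exact HomPolyBasics.homPoly_map_equiv E ea eb m
  · simp only [A, B, Fintype.card_subtype_compl, Fintype.card_subtype_le, Nat.add_sub_cancel']
  · simp [F, E]

/-! ### BLOCK DESCENT, span form -/

/-- **BLOCK DESCENT (span form, every degree).**  An off-diagonal block substitution maps the ONE-SORTED narrow
span of width `w` at level `n + n` (patterns of any order and degree, any number of terms) into the BIPARTITE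
narrow span of the SAME width `w` at level `n`: generator by generator, `Φ(dihom_{D,n+n}) = N_D • dihom_{D,n}`
vanishes unless `D` has a consistent 2-colouring, in which case `dihom_{D,n}` is the homomorphism polynomial of a
bipartite pattern of treewidth `≤ tw D`. [folklore] -/
theorem block_descent_span (φ : Fin (n + n) × Fin (n + n) → MvPolynomial (Fin n × Fin n) ℂ)
    (hφ : ∀ i j : Fin n, φ (finSumFinEquiv (Sum.inl i), finSumFinEquiv (Sum.inr j)) = X (i, j) ∧
      φ (finSumFinEquiv (Sum.inl i), finSumFinEquiv (Sum.inl j)) = 0 ∧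
      φ (finSumFinEquiv (Sum.inr i), finSumFinEquiv (Sum.inl j)) = 0 ∧
      φ (finSumFinEquiv (Sum.inr i), finSumFinEquiv (Sum.inr j)) = 0)
    (w : ℕ) (p : MvPolynomial (Fin (n + n) × Fin (n + n)) ℂ)
    (hp : p ∈ Submodule.span ℂ {q : MvPolynomial (Fin (n + n) × Fin (n + n)) ℂ |
      ∃ (a : ℕ) (D : Multiset (Fin a × Fin a)),
        treewidth (SimpleGraph.fromRel fun u v : Fin a => ∃ e ∈ D, u = e.1 ∧ v = e.2) ≤ w ∧
          q = diHomPoly D (n + n) ℂ}) :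
    aeval φ p ∈ Submodule.span ℂ {q : MvPolynomial (Fin n × Fin n) ℂ |
      ∃ (a b : ℕ) (F : Multiset (Fin a × Fin b)),
        treewidth (SimpleGraph.fromRel fun u v : Fin a ⊕ Fin b =>
            ∃ e ∈ F, u = Sum.inl e.1 ∧ v = Sum.inr e.2) ≤ w ∧
          q = homPoly F n ℂ} := by
  induction hp using Submodule.span_induction with
  | mem q hq =>
    obtain ⟨a, D, hD, rfl⟩ := hq
    rw [aeval_block_diHomPoly φ hφ D]
    by_cases hN : (Finset.univ.filter fun c : Fin a → Bool => ∀ d ∈ D, c d.1 = false ∧ c d.2 = true) = ∅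
    · rw [hN, Finset.card_empty, Nat.cast_zero, zero_smul]
      exact Submodule.zero_mem _
    · obtain ⟨c, hc⟩ := Finset.nonempty_iff_ne_empty.2 hN
      obtain ⟨a', b', F, hF, hFhom, -, -⟩ :=
        exists_homPoly_eq_diHomPoly_of_colouring D c (Finset.mem_filter.1 hc).2 n
      refine Submodule.smul_mem _ _ (Submodule.subset_span ⟨a', b', F, hF.trans hD, hFhom.symm⟩)
  | zero => rw [map_zero]; exact Submodule.zero_mem _
  | add x y _ _ hx hy => rw [map_add]; exact Submodule.add_mem _ hx hy
  | smul r x _ hx => rw [map_smul]; exact Submodule.smul_mem _ r hx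

/-! ### Block substitution of bipartite homomorphism polynomials -/

/-- Under an off-diagonal block substitution, the BIPARTITE homomorphism polynomial of `E` at level `n + n`
becomes `N • hom_{E,n}` with `N` the number of 2-colourings of the oriented pattern (vertex type `Fin (a + b)`,
rows `inl`, columns `inr`, `SubThresholdDescent.diHomPoly_orientFin`) putting every row end of an edge in the row
block and every column end in the column block (`N = 2^{#isolated vertices} ≥ 1`). [folklore] -/
theorem aeval_block_homPoly (φ : Fin (n + n) × Fin (n + n) → MvPolynomial (Fin n × Fin n) ℂ)
    (hφ : ∀ i j : Fin n, φ (finSumFinEquiv (Sum.inl i), finSumFinEquiv (Sum.inr j)) = X (i, j) ∧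
      φ (finSumFinEquiv (Sum.inl i), finSumFinEquiv (Sum.inl j)) = 0 ∧
      φ (finSumFinEquiv (Sum.inr i), finSumFinEquiv (Sum.inl j)) = 0 ∧
      φ (finSumFinEquiv (Sum.inr i), finSumFinEquiv (Sum.inr j)) = 0)
    {a b : ℕ} (E : Multiset (Fin a × Fin b)) :
    aeval φ (homPoly E (n + n) ℂ) =
      ((Finset.univ.filter fun c : Fin (a + b) → Bool =>
          ∀ e ∈ E, c (finSumFinEquiv (Sum.inl e.1)) = false ∧
            c (finSumFinEquiv (Sum.inr e.2)) = true).card : ℂ) • homPoly E n ℂ := by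
  rw [← SubThresholdDescent.diHomPoly_orientFin E (n + n), aeval_block_diHomPoly φ hφ,
    SubThresholdDescent.diHomPoly_orientFin E n]
  congr 3
  ext c
  simp only [Finset.mem_filter, Finset.mem_univ, true_and, Multiset.forall_mem_map_iff]

/-- In particular, for a bipartite pattern WITHOUT ISOLATED VERTICES the only admissible 2-colouring is
(rows ↦ row block, columns ↦ column block): `Φ(hom_{E,n+n}) = hom_{E,n}` — the off-diagonal block substitution
READS A BIPARTITE EXPANSION ONE LEVEL DOWN. [folklore] -/
theorem aeval_block_homPoly_of_noIsolated (φ : Fin (n + n) × Fin (n + n) → MvPolynomial (Fin n × Fin n) ℂ)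
    (hφ : ∀ i j : Fin n, φ (finSumFinEquiv (Sum.inl i), finSumFinEquiv (Sum.inr j)) = X (i, j) ∧
      φ (finSumFinEquiv (Sum.inl i), finSumFinEquiv (Sum.inl j)) = 0 ∧
      φ (finSumFinEquiv (Sum.inr i), finSumFinEquiv (Sum.inl j)) = 0 ∧
      φ (finSumFinEquiv (Sum.inr i), finSumFinEquiv (Sum.inr j)) = 0)
    {a b : ℕ} (E : Multiset (Fin a × Fin b))
    (hrow : ∀ u : Fin a, ∃ e ∈ E, e.1 = u) (hcol : ∀ v : Fin b, ∃ e ∈ E, e.2 = v) :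
    aeval φ (homPoly E (n + n) ℂ) = homPoly E n ℂ := by
  rw [aeval_block_homPoly φ hφ E]
  have hset : (Finset.univ.filter fun c : Fin (a + b) → Bool =>
      ∀ e ∈ E, c (finSumFinEquiv (Sum.inl e.1)) = false ∧ c (finSumFinEquiv (Sum.inr e.2)) = true) =
      {fun u => (finSumFinEquiv.symm u).elim (fun _ => false) (fun _ => true)} := by
    ext c
    simp only [Finset.mem_filter, Finset.mem_univ, true_and, Finset.mem_singleton]
    constructor
    · intro h
      funext u
      obtain ⟨x, rfl⟩ := finSumFinEquiv.surjective u
      rw [Equiv.symm_apply_apply]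
      rcases x with i | j
      · obtain ⟨e, he, rfl⟩ := hrow i
        exact (h e he).1
      · obtain ⟨e, he, rfl⟩ := hcol j
        exact (h e he).2
    · rintro rfl e _
      simp only [Equiv.symm_apply_apply, Sum.elim_inl, Sum.elim_inr, and_self]
  rw [hset, Finset.card_singleton, Nat.cast_one, one_smul]

/-! ### A concrete off-diagonal block substitution -/

/-- The off-diagonal block substitution EXISTS (concretely: `y_(i,j) ↦ x_(i', j')` when `i = inl i'` lies in the
row block and `j = inr j'` in the column block of `Fin (n + n) ≃ Fin n ⊕ Fin n`, and `↦ 0` otherwise).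
[folklore] -/
theorem exists_block (n : ℕ) :
    ∃ φ : Fin (n + n) × Fin (n + n) → MvPolynomial (Fin n × Fin n) ℂ,
      ∀ i j : Fin n, φ (finSumFinEquiv (Sum.inl i), finSumFinEquiv (Sum.inr j)) = X (i, j) ∧
        φ (finSumFinEquiv (Sum.inl i), finSumFinEquiv (Sum.inl j)) = 0 ∧
        φ (finSumFinEquiv (Sum.inr i), finSumFinEquiv (Sum.inl j)) = 0 ∧
        φ (finSumFinEquiv (Sum.inr i), finSumFinEquiv (Sum.inr j)) = 0 := by
  refine ⟨fun ij => Sum.elim (fun i => Sum.elim (fun _ => 0) (fun j => X (i, j)) (finSumFinEquiv.symm ij.2))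
    (fun _ => 0) (finSumFinEquiv.symm ij.1), fun i j => ⟨?_, ?_, ?_, ?_⟩⟩ <;>
  simp only [Equiv.symm_apply_apply, Sum.elim_inl, Sum.elim_inr]

/-! ### BLOCK DESCENT for uniform expansion data (every degree) -/

/-- **BLOCK DESCENT, UNIFORM DATA, EVERY DEGREE.**  Let `Σ_i α_i • hom_{E_i}` be a finite formal combination of
bipartite patterns without isolated vertices (any number of rows, columns and edges — in particular ANY DEGREE,
above or below the injective threshold).  If its evaluation at level `n + n` lies in the ONE-SORTED narrow span of
width `w` (level `n + n`), then its evaluation at level `n` lies in the BIPARTITE narrow span of the same width `w`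
(level `n`).  (Apply the off-diagonal block substitution: it reads the combination one level down,
`aeval_block_homPoly_of_noIsolated`, and maps one-sorted narrowness to bipartite narrowness, `block_descent_span`.)
Compare the sub-threshold descent `SubThresholdDescent.subThreshold_descent` (same level, degree `≤ n/2`).
[folklore] -/
theorem block_descent_uniform (n w : ℕ) {ι : Type} [Fintype ι] (a b : ι → ℕ)
    (E : (i : ι) → Multiset (Fin (a i) × Fin (b i))) (α : ι → ℂ)
    (hrow : ∀ i (u : Fin (a i)), ∃ e ∈ E i, e.1 = u) (hcol : ∀ i (v : Fin (b i)), ∃ e ∈ E i, e.2 = v)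
    (h : (∑ i, α i • homPoly (E i) (n + n) ℂ) ∈ Submodule.span ℂ {q : MvPolynomial (Fin (n + n) × Fin (n + n)) ℂ |
      ∃ (a : ℕ) (D : Multiset (Fin a × Fin a)),
        treewidth (SimpleGraph.fromRel fun u v : Fin a => ∃ e ∈ D, u = e.1 ∧ v = e.2) ≤ w ∧
          q = diHomPoly D (n + n) ℂ}) :
    (∑ i, α i • homPoly (E i) n ℂ) ∈ Submodule.span ℂ {q : MvPolynomial (Fin n × Fin n) ℂ |
      ∃ (a b : ℕ) (F : Multiset (Fin a × Fin b)),
        treewidth (SimpleGraph.fromRel fun u v : Fin a ⊕ Fin b =>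
            ∃ e ∈ F, u = Sum.inl e.1 ∧ v = Sum.inr e.2) ≤ w ∧
          q = homPoly F n ℂ} := by
  obtain ⟨φ, hφ⟩ := exists_block n
  have key := block_descent_span φ hφ w _ h
  rw [map_sum] at key
  simp only [map_smul, aeval_block_homPoly_of_noIsolated φ hφ _ (hrow _) (hcol _)] at key
  exact key

end Summit.ValiantsHypothesis.ValiantsHypothesis.Theorems.BlockDescent

end
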